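import Summits.KontsevichZagierPeriods.KontsevichZagierPeriods.Theses.GenericPointClass
import Summits.KontsevichZagierPeriods.KontsevichZagierPeriods.Theorems.InverseLandauTateLiftingParabolaDescends

/-!
# `ParabolaDescends` (stmt-KontsevichZagierPeriods-4431, route `GenericPointClass`) — proof

The support item `ParabolaDescends` of route `GenericPointClass`: for integral representations
`r = [(0,1)², 1/(y − x² − 5)]`, `s₀ = [(0,1), 1/(y − 6)]`, `s₁ = [(0,1), 2y²(1/(y²+5) − 1/(y²+4))]`
(pinned by their domains and by their integrands on them), `[r] − [s₀] − [s₁] ∈ KZ.relations`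
(integration by parts inside Kontsevich–Zagier's rules). It is, verbatim, the theorem
`Summit.KontsevichZagierPeriods.InverseLandau.tateLifting_parabolaDescends` of
`Theorems/InverseLandauTateLiftingParabolaDescends.lean` (line `Sketch` of crux `TateLifting`,
stmt-KontsevichZagierPeriods-9129, lead c10), which this file merely re-exports under the route's
name.
-/

namespace Summit.KontsevichZagierPeriods.GenericPointClass

/-- **`ParabolaDescends`** (route `GenericPointClass`, stmt-KontsevichZagierPeriods-4431):
`[(0,1)², 1/(y − x² − 5)] − [(0,1), 1/(y − 6)] − [(0,1), 2y²(1/(y²+5) − 1/(y²+4))] ∈ KZ.relations`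
for representations pinned by domain and integrand. Proof:
`InverseLandau.tateLifting_parabolaDescends` (integrand additivity, one coordinate swap and two
Newton–Leibniz moves with the rational primitives `x/(y − x² − 5)`, `2x²/(y − x² − 5)`).
[cite: KontsevichZagier2001, §1.2] -/
theorem parabolaDescends_proof :
    Summit.KontsevichZagierPeriods.KontsevichZagierPeriods.Theses.GenericPointClass.ParabolaDescends :=
  Summit.KontsevichZagierPeriods.InverseLandau.tateLifting_parabolaDescends

end Summit.KontsevichZagierPeriods.GenericPointClass
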